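import Mathlib
import Literature.Combinatorics.Optimization.CorrelationPolytopeGridMinor
import Literature.Computability.MetaComplexity.GridTseitinLift
import Summits.ValiantsHypothesis.ValiantsHypothesis.Theorems.FifoMatchingGridCorShadowFaceLift
import Summits.ValiantsHypothesis.ValiantsHypothesis.Theorems.FifoMatchingGridCorShadowCliqueParabola
import Summits.ValiantsHypothesis.ValiantsHypothesis.Theorems.FifoMatchingNFPolytopeQueueGridCorProjection
import Summits.ValiantsHypothesis.ValiantsHypothesis.Theses.FifoMatching
import HarnessLib

/-!
# G♭ ⇒ G: the AFHMS clique face of `COR(G_{t,t})` forces a planar shadow with `> 2^((log₂ t + c)^c)` vertices —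
# BY NAME against the route item `Theses.FifoMatching.GridCorCliqueFace` (stmt-ValiantsHypothesis-27045)

Port to `Theorems/` (director-valiant g12 R180 (b)(i), val-lit desk #270 (c): val-port-2 = S-port hand) of § «G♭ ⇒ G» of
val-idea-7 g7's kernel-checked line workfile `Cruxes/NNLinearDegreeCofactorHard/Lines/shadow_division.lean` rev 5b
(`gridCorShadowHard_of_cliqueFace`, crit-3 VERDICT #21/#21b: P1 met), with NO definitions: the line's σ-currency
`GridCorShadowHard` / `shadowVerts` / `T` are UNFOLDED in the statement (crit-3 #21b port note (a): Theorems-side ports are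
stated over the route decls by name and explicit binders, not over fresh `Prop` defs), so the line file takes the theorem
with `:= gridCorShadowHard_of_cliqueFace hF` after unfolding its own abbreviations.

* `four_T_lt_two_pow` — growth: `4 · 2^((log₂ t + c)^c) < 2^h` whenever `h ≥ c₀ t`, eventually in `t` (from c1's
  `QueueGridFace.growth_eventually`, consumed by name).
* ★ `gridCorShadowHard_of_cliqueFace` — from the route item G♭ (`GridCorCliqueFace`: for some `c > 0`, eventually in `t`,
  an `h ≥ c·t`, finitely many inequalities valid on `COR(G_{t,t})` and a linear `π` with
  `π (COR(G_{t,t}) ∩ {all tight}) = COR(K_h)` [AFHMS 2019, arXiv:1806.00541 pp. 5–6]) to G: for every `c`, eventually in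
  `t`, some planar linear shadow of the vertex set `range (corVec (gridGraph t))` of `COR(G_{t,t})` has more than
  `2^((log₂ t + c)^c)` hull vertices.  Proof = the summed valid inequality `Σ_i cvᵢ·x ≤ Σ_i δᵢ` cuts out the same face;
  the face of the hull is the hull of the face points (`convexHull_inter_face`); their `π`-read-out has hull `COR(K_h)`,
  whose parabola shadow has `2^h` vertices (HY21 Prop 19, `clique_parabola_shadow`); the face lift
  (`shadow_faceLift_count_face`, HY21 Lemma 10) realises a quarter of them as vertices of a shadow of the whole vertex set;
  and `4·2^((log₂ t + c)^c) < 2^h` for `h ≥ c₀ t` eventually.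

HONEST FRAMING: a CONDITIONAL transfer inside an OPEN line — its hypothesis G♭ = stmt-27045 is OPEN (construction hands
p10 g2 / p9 g1 / p4 g12), the line's other input A1 `QueueGridZeroOnePoints` is OPEN, K1 stmt-26254 is closed only
conditionally; no rung of record moves; nothing here bears on `VP ≠ VNP`, which is NOT proved.
-/

set_option autoImplicit false

-- the mandated summit-side namespace repeats a component by design (single-problem summit)
set_option linter.dupNamespace false

namespace Summit.ValiantsHypothesis.ValiantsHypothesis.Theorems.FifoMatching

namespace GridCorShadow

open Matrix
open Literature.Combinatorics.Optimization (corVec corPolytopeGraph)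
open Literature.Computability.MetaComplexity (gridGraph)
open Summit.ValiantsHypothesis.ValiantsHypothesis.Theorems.FifoMatching.QueueGridFace (growth_eventually)
open Summit.ValiantsHypothesis.ValiantsHypothesis.Theses.FifoMatching (GridCorCliqueFace)

/-- growth: `4 · 2^((log₂ t + c)^c) < 2^h` whenever `h ≥ c₀ t`, eventually in `t` (from c1's `growth_eventually`). -/
theorem four_T_lt_two_pow (c : ℕ) {c₀ : ℝ} (hc₀ : 0 < c₀) :
    ∃ t₁ : ℕ, ∀ t ≥ t₁, ∀ h : ℕ, c₀ * t ≤ h → 4 * 2 ^ ((Nat.log 2 t + c) ^ c) < 2 ^ h := by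
  obtain ⟨r₀, _, hr₀⟩ := growth_eventually c (half_pos hc₀)
  refine ⟨max r₀ (Nat.ceil (3 / c₀)), fun t ht h hh => ?_⟩
  have htr : r₀ ≤ t := le_of_max_le_left ht
  have htc : Nat.ceil (3 / c₀) ≤ t := le_of_max_le_right ht
  have h3 : 3 ≤ c₀ * t := by
    have h1 : 3 / c₀ ≤ (t : ℝ) := le_trans (Nat.le_ceil _) (by exact_mod_cast htc)
    have := mul_le_mul_of_nonneg_left h1 hc₀.le
    rwa [mul_div_cancel₀ _ hc₀.ne'] at this
  have hA := hr₀ t htr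
  have h4pos : (0 : ℝ) ≤ 4 * (t : ℝ) ^ 4 := by positivity
  have hA' : (2 : ℝ) ^ ((Nat.log 2 t + c) ^ c) < (2 : ℝ) ^ (c₀ / 2 * ((t / 2 : ℕ) : ℝ)) := by linarith
  have hexp1 : c₀ / 2 * ((t / 2 : ℕ) : ℝ) ≤ c₀ * t / 4 := by
    have : ((t / 2 : ℕ) : ℝ) ≤ (t : ℝ) / 2 := Nat.cast_div_le
    nlinarith
  have hexp2 : (2 : ℝ) + c₀ * t / 4 ≤ c₀ * t := by linarith
  have hB : (4 : ℝ) * (2 : ℝ) ^ (c₀ / 2 * ((t / 2 : ℕ) : ℝ)) ≤ (2 : ℝ) ^ (h : ℝ) := by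
    have e4 : (4 : ℝ) = (2 : ℝ) ^ (2 : ℝ) := by norm_num
    rw [e4, ← Real.rpow_add two_pos]
    exact Real.rpow_le_rpow_of_exponent_le one_le_two (by linarith)
  have hfin : ((4 * 2 ^ ((Nat.log 2 t + c) ^ c) : ℕ) : ℝ) < ((2 ^ h : ℕ) : ℝ) := by
    push_cast
    rw [← Real.rpow_natCast 2 h]
    calc (4 : ℝ) * 2 ^ ((Nat.log 2 t + c) ^ c) < 4 * (2 : ℝ) ^ (c₀ / 2 * ((t / 2 : ℕ) : ℝ)) := by linarith
      _ ≤ (2 : ℝ) ^ (h : ℝ) := hB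
  exact_mod_cast hfin

/-- **G♭ ⇒ G** (kernel-checked, BY NAME against the route item `Theses.FifoMatching.GridCorCliqueFace` = stmt-27045):
from the AFHMS clique face, for every `c`, eventually in `t`, some planar linear shadow of the vertex set of `COR(G_{t,t})`
has more than `2^((log₂ t + c)^c)` hull vertices.  (This is the line's `GridCorShadowHard` with `shadowVerts`/`T` unfolded.)
[AboulkerEtAl2019 pp. 5–6; HrubesYehudayoff2021 Prop. 19 p.10, Lemma 10 p.7] -/
theorem gridCorShadowHard_of_cliqueFace (hF : GridCorCliqueFace) :
    ∀ c : ℕ, ∃ t₀ : ℕ, ∀ t ≥ t₀, ∃ L : ((Fin (t * t) × Fin (t * t)) → ℝ) →ₗ[ℝ] (Fin 2 → ℝ),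
      2 ^ ((Nat.log 2 t + c) ^ c) <
        (Set.extremePoints ℝ (convexHull ℝ (L '' Set.range (corVec (gridGraph t))))).ncard := by
  classical
  intro c
  obtain ⟨c₀, hc₀, t₀, hF⟩ := hF
  obtain ⟨t₁, ht₁⟩ := four_T_lt_two_pow c hc₀
  refine ⟨max t₀ t₁, fun t ht => ?_⟩
  obtain ⟨h, hh, k, cv, δ, π, hvalid, hface⟩ := hF t (le_of_max_le_left ht)
  set S : Set (Fin (t * t) × Fin (t * t) → ℝ) := Set.range (corVec (gridGraph t)) with hSdef
  have hP : corPolytopeGraph (gridGraph t) = convexHull ℝ S := rfl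
  have hSfin : S.Finite := Set.finite_range _
  -- the summed valid inequality `w x ≤ w₀` (a proof-local structure, not a declaration) and its face
  let w : (Fin (t * t) × Fin (t * t) → ℝ) →ₗ[ℝ] ℝ :=
    { toFun := fun x => ∑ i, cv i ⬝ᵥ x
      map_add' := fun x y => by simp [dotProduct_add, Finset.sum_add_distrib]
      map_smul' := fun a x => by simp [dotProduct_smul, Finset.mul_sum, smul_eq_mul] }
  have hw : ∀ x, w x = ∑ i, cv i ⬝ᵥ x := fun x => rfl
  let w₀ : ℝ := ∑ i, δ i
  have hvalidP : ∀ x ∈ convexHull ℝ S, w x ≤ w₀ := fun x hx => by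
    rw [hw]
    exact Finset.sum_le_sum fun i _ => hvalid i x (hP ▸ hx)
  have hvalidS : ∀ x ∈ S, w x ≤ w₀ := fun x hx => hvalidP x (subset_convexHull ℝ S hx)
  have htight : ∀ x ∈ convexHull ℝ S, ((∀ i, cv i ⬝ᵥ x = δ i) ↔ w x = w₀) := by
    intro x hx
    rw [hw]
    constructor
    · intro hall; exact Finset.sum_congr rfl fun i _ => hall i
    · intro hsum i
      have := (Finset.sum_eq_sum_iff_of_le (fun i _ => hvalid i x (hP ▸ hx))).1 hsum
      exact this i (Finset.mem_univ i)
  -- the face read-out `Y` and its hull `= COR(K_h)`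
  set Y : Set (Fin h × Fin h → ℝ) := π '' (S ∩ {x | w x = w₀}) with hYdef
  have hconvY : convexHull ℝ Y = corPolytopeGraph (⊤ : SimpleGraph (Fin h)) := by
    rw [← hface, hP]
    have hE : convexHull ℝ S ∩ {x | ∀ i, cv i ⬝ᵥ x = δ i} = convexHull ℝ S ∩ {x | w x = w₀} := by
      ext x; constructor
      · rintro ⟨hx, hall⟩; exact ⟨hx, (htight x hx).1 hall⟩
      · rintro ⟨hx, hw'⟩; exact ⟨hx, (htight x hx).2 hw'⟩
    rw [hE, convexHull_inter_face S w w₀ hvalidS, LinearMap.image_convexHull]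
  -- the parabola shadow of `Y` has `2^h` vertices (HY21 Prop 19)
  obtain ⟨Λ, hΛ⟩ := clique_parabola_shadow h
  have hcount : (Set.extremePoints ℝ (convexHull ℝ (Λ '' Y))).ncard = 2 ^ h := by
    have : convexHull ℝ (Λ '' Y) =
        convexHull ℝ (Λ '' Set.range (corVec (⊤ : SimpleGraph (Fin h)))) := by
      rw [← LinearMap.image_convexHull, hconvY, corPolytopeGraph, LinearMap.image_convexHull]
    rw [this]; exact hΛ
  have hB : 4 * 2 ^ ((Nat.log 2 t + c) ^ c) < (Set.extremePoints ℝ (convexHull ℝ (Λ '' Y))).ncard := by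
    rw [hcount]; exact ht₁ t (le_of_max_le_right ht) h hh
  obtain ⟨L, hL⟩ :=
    shadow_faceLift_count_face S hSfin w w₀ hvalidS π Y rfl Λ (2 ^ ((Nat.log 2 t + c) ^ c)) hB
  exact ⟨L, hL⟩

end GridCorShadow

end Summit.ValiantsHypothesis.ValiantsHypothesis.Theorems.FifoMatching
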